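import Summits.NavierStokesRegularity.FunctionalMining.ThreeWaveStrain
import Summits.NavierStokesRegularity.FunctionalMining.ThreeWaveFourierTables
import Summits.NavierStokesRegularity.FunctionalMining.MiddleEigenvalueMomentDoor
import Literature.Analysis.FluidPDE.BeltramiWavesCurl
import HarnessLib

/-!
# K1-Q2 kernel instance (part 3/3): the three-wave field refutes `MiddleEigenvalueMomentRateBound 4 1` and `6 2`

NS FUNCTIONAL MINING cell (`pub-nsfunc`), dictionary seat — **search for candidate a priori
estimates; no regularity claim.** Nothing in this file asserts anything about Navier–Stokes
regularity: it is one explicit smooth divergence-free field on `T³`, four exact integrals, one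
pointwise eigenvalue bound, and the resulting refutation of FINITE constants in the K0 family
`E.q|T_C|C3b` (Miller-type middle-eigenvalue moment laws, `Candidates.MiddleEigenvalueMomentRateBound`).

## What is proved (kernel-checked; imports the tree door module)

For the tree's three-wave field `w = ThreeWaveTorus.w = (2cos 2πx₁, 0, 2cos 2πx₀ + 2sin 2π(x₀+x₁))`
(`FunctionalMining/ThreeWaveWitness`, p195100), writing `f = |ω|² = torusVorticitySqAt w`,
`σ = torusStretchingDensity w` (`= ωᵀSω`), `λ₂` = middle eigenvalue of the strain
`S = ½((∂ⱼw)ᵢ + (∂ᵢw)ⱼ)` (Mathlib's decreasing `eigenvalues₀`, index `1`, the convention of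
`MiddleEigenvalueMomentRateBound`):

* `middle_le_of_det_branch` (part 1) — the eigenvalue kit `det(t − M) ≤ 0 ∧ t ≥ 0 ⇒ λ₂(M) ≤ t` for real
  symmetric trace-free `3×3` matrices (spectral theorem: `det = ∏λᵢ`, `Σλᵢ = 0`);
* the nine first derivatives of `w` (only `p = ∂₁w₀`, `q = ∂₀w₂`, `r = ∂₁w₂` are non-zero), hence
  `f = p² + q² + r²`, `σ = −pqr` (`torusVorticitySqAt_w`, `torusStretchingDensity_w`);
* the exact Fourier tables of `f`, `σ`, `f²` as coordinates of ONE auxiliary real trigonometric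
  polynomial (`realTrigPoly S₁ c₁`, `realTrigPoly S₂ c₂`; pointwise identities `aux₁_apply_zero/one`, `aux₂_apply_*`),
  and by Parseval (`integral_mul_realTrigPoly`, lit) the integrals
  `∫ f² = 92·(2π)⁴`, `∫ f σ = 36·(2π)⁵`, `∫ f³ = 1376·(2π)⁶`, `∫ f²σ = 676·(2π)⁷` — the census-2 exact-lane
  numbers `Z₄ = 92`, `Q₂ = 36`, `Z₆ = 1376`, `Q₃ = 676` (per-`(2π)³` averages, `INBOX.md` 2026-08-20T02:14Z), now theorems;
* `det S(x) = pqr/4` and `det(|p|/2 − S) = −|p|(q ± r)²/8 ≤ 0`, hence `λ₂(S(x)) ≤ |p(x)|/2 ≤ Λ := 2π`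
  everywhere (`middleEigenvalue_le_w`, part 1; the sharp sup is `(√3−1)·2π ≈ 0.732·2π`, certified
  `≤ (3/4)·2π` by the cell's exact branch-and-bound certificates but not needed here);
* the door step dynamic ⇒ static at this field is the tree lemma
  `MiddleEigenvalueMomentRateBound.static_evenMoment` of `FunctionalMining/MiddleEigenvalueMomentDoor`
  (local smooth Euler solution from `w`, exact derivative of `Z_{2m}` at `t = 0`) — this variant of the
  file IMPORTS the door instead of inlining it;
* **`not_middleEigenvalueMomentRateBound_four : C < 36/23 → ¬ MiddleEigenvalueMomentRateBound 4 C`** on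
  `T³` (`C·Λ·∫f² = 92C·(2π)⁵ < 144·(2π)⁵ = 2·2·∫fσ`), corollaries `…_four_one` (`C = 1`),
  `…_four_three_halves` (`C = 3/2`);
* **`not_middleEigenvalueMomentRateBound_six : C < 507/172 → ¬ MiddleEigenvalueMomentRateBound 6 C`**
  (`1376C·(2π)⁷ < 4056·(2π)⁷ = 2·3·∫f²σ`), corollaries `…_six_two` (`C = 2`: the Betchov–Miller
  calibration constant of `q = 2` FAILS at `q = 6`), `…_six_five_halves`.

Calibration / honesty: at `q = 2` the law HOLDS with `C = 2` (tree, Miller L5.1); the kills here are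
finite-`C` kills at `q = 4` and `q = 6` by a `z`-independent (2.5D) field, for which `σ = −4 det S` and no
KILL-ALL certificate is possible (dictionary door § 6). They say only that the constant `C` in a
Miller-type law `dZ_q/dt ≤ C·(sup λ₂⁺)·Z_q` cannot be `< 36/23` at `q = 4` (`< 507/172` at `q = 6`) —
nothing about regularity. Search for candidate a priori estimates; no regularity claim.
-/

noncomputable section

open Set MeasureTheory Complex Finset
open scoped RealInnerProductSpace ComplexConjugate

namespace Summit.NavierStokesRegularity.FunctionalMining

open Literature.Analysis Literature.Analysis.FunctionSpaces Literature.Analysis.FunctionSpaces.Torus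
open Literature.Analysis.FluidPDE Literature.Analysis.FluidPDE.IntermittentBeltrami UnitAddTorus
open ThreeWaveTorus

namespace MiddleEigenKill

set_option linter.unusedSimpArgs false
set_option linter.unusedTactic false
set_option linter.unreachableTactic false
set_option linter.unnecessarySeqFocus false

/-! ### Pointwise identification -/

set_option maxHeartbeats 1600000 in
/-- **`Re ∑_{k∈S₁} e_k(x) f̂(k) = |ω(x)|²`**: coordinate `0` of the auxiliary polynomial is `|ω|²`
(polynomial identity in `Re X, Im X, Re Y, Im Y` modulo `|X| = |Y| = 1`). [ours; elementary] -/
theorem aux₁_apply_zero (x : UnitAddTorus (Fin 3)) :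
    realTrigPoly S₁ c₁ x 0 = pX x ^ 2 + qX x ^ 2 + rX x ^ 2 := by
  have hX := normSq_mFourier e1 x
  have hY := normSq_mFourier e2 x
  rw [realTrigPoly_apply_coord, trigPoly_apply_coord, sum_S₁]
  simp only [c₁_apply_zero, val_zero, val_m01, val_neg_m01, val_m02, val_neg_m02, val_m20, val_neg_m20, val_m21, val_neg_m21, val_m22, val_neg_m22, val_m23, val_neg_m23,
    mFourier_neg, char_m01, char_m02, char_m20, char_m21, char_m22, char_m23, mFourier_zero, ContinuousMap.one_apply, pX, qX, rX]
  simp only [Complex.add_re, Complex.add_im, Complex.sub_re, Complex.sub_im, Complex.mul_re,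
    Complex.mul_im, Complex.neg_re, Complex.neg_im, Complex.conj_re, Complex.conj_im, Complex.I_re,
    Complex.I_im, Complex.ofReal_re, Complex.ofReal_im, Complex.one_re, Complex.one_im, Complex.zero_re,
    Complex.zero_im, Complex.re_ofNat, Complex.im_ofNat, mul_zero, zero_mul, sub_zero, add_zero, mul_one,
    one_mul, zero_add, zero_sub, neg_zero]
  linear_combination ((-8 : ℝ) * Real.pi ^ 2 + (-16 : ℝ) * Real.pi ^ 2 * (mFourier e2 x).im + (-16 : ℝ) * Real.pi ^ 2 * (mFourier e2 x).im ^ 2 + (-16 : ℝ) * Real.pi ^ 2 * (mFourier e2 x).re ^ 2) * hX + ((-24 : ℝ) * Real.pi ^ 2) * hY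

set_option maxHeartbeats 1600000 in
/-- **`Re ∑_{k∈S₁} e_k(x) σ̂(k) = σ(x) = −pqr`**. [ours; elementary] -/
theorem aux₁_apply_one (x : UnitAddTorus (Fin 3)) :
    realTrigPoly S₁ c₁ x 1 = -(pX x * qX x * rX x) := by
  have hX := normSq_mFourier e1 x
  have hY := normSq_mFourier e2 x
  rw [realTrigPoly_apply_coord, trigPoly_apply_coord, sum_S₁]
  simp only [c₁_apply_one, val_zero, val_m01, val_neg_m01, val_m02, val_neg_m02, val_m20, val_neg_m20, val_m21, val_neg_m21, val_m22, val_neg_m22, val_m23, val_neg_m23,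
    mFourier_neg, char_m01, char_m02, char_m20, char_m21, char_m22, char_m23, mFourier_zero, ContinuousMap.one_apply, pX, qX, rX]
  simp only [Complex.add_re, Complex.add_im, Complex.sub_re, Complex.sub_im, Complex.mul_re,
    Complex.mul_im, Complex.neg_re, Complex.neg_im, Complex.conj_re, Complex.conj_im, Complex.I_re,
    Complex.I_im, Complex.ofReal_re, Complex.ofReal_im, Complex.one_re, Complex.one_im, Complex.zero_re,
    Complex.zero_im, Complex.re_ofNat, Complex.im_ofNat, mul_zero, zero_mul, sub_zero, add_zero, mul_one,
    one_mul, zero_add, zero_sub, neg_zero]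
  linear_combination ((16 : ℝ) * Real.pi ^ 3 + (16 : ℝ) * Real.pi ^ 3 * (mFourier e2 x).im + (-48 : ℝ) * Real.pi ^ 3 * (mFourier e2 x).im ^ 2 + (-48 : ℝ) * Real.pi ^ 3 * (mFourier e2 x).im ^ 3 + (-16 : ℝ) * Real.pi ^ 3 * (mFourier e2 x).re ^ 2 + (-48 : ℝ) * Real.pi ^ 3 * (mFourier e2 x).re ^ 2 * (mFourier e2 x).im) * hX + ((-32 : ℝ) * Real.pi ^ 3 + (-48 : ℝ) * Real.pi ^ 3 * (mFourier e2 x).im + (32 : ℝ) * Real.pi ^ 3 * (mFourier e1 x).re * (mFourier e1 x).im * (mFourier e2 x).re + (32 : ℝ) * Real.pi ^ 3 * (mFourier e1 x).re ^ 2 + (32 : ℝ) * Real.pi ^ 3 * (mFourier e1 x).re ^ 2 * (mFourier e2 x).im) * hY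

set_option maxHeartbeats 3200000 in
/-- Coordinate `0` of `realTrigPoly S₂ c₂` is `|ω|²`. [ours; elementary] -/
theorem aux₂_apply_zero (x : UnitAddTorus (Fin 3)) :
    realTrigPoly S₂ c₂ x 0 = pX x ^ 2 + qX x ^ 2 + rX x ^ 2 := by
  have hX := normSq_mFourier e1 x
  have hY := normSq_mFourier e2 x
  rw [realTrigPoly_apply_coord, trigPoly_apply_coord, sum_S₂]
  simp only [c₂_apply_zero, val_zero, val_m01, val_neg_m01, val_m02, val_neg_m02, val_m03, val_neg_m03, val_m04, val_neg_m04, val_m2n2, val_neg_m2n2, val_m2n1, val_neg_m2n1, val_m20, val_neg_m20, val_m21, val_neg_m21, val_m22, val_neg_m22, val_m23, val_neg_m23, val_m24, val_neg_m24, val_m40, val_neg_m40, val_m41, val_neg_m41, val_m42, val_neg_m42, val_m43, val_neg_m43, val_m44, val_neg_m44,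
    mFourier_neg, char_m01, char_m02, char_m03, char_m04, char_m2n2, char_m2n1, char_m20, char_m21, char_m22, char_m23, char_m24, char_m40, char_m41, char_m42, char_m43, char_m44, mFourier_zero, ContinuousMap.one_apply, pX, qX, rX]
  simp only [Complex.add_re, Complex.add_im, Complex.sub_re, Complex.sub_im, Complex.mul_re,
    Complex.mul_im, Complex.neg_re, Complex.neg_im, Complex.conj_re, Complex.conj_im, Complex.I_re,
    Complex.I_im, Complex.ofReal_re, Complex.ofReal_im, Complex.one_re, Complex.one_im, Complex.zero_re,
    Complex.zero_im, Complex.re_ofNat, Complex.im_ofNat, mul_zero, zero_mul, sub_zero, add_zero, mul_one,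
    one_mul, zero_add, zero_sub, neg_zero]
  linear_combination ((-8 : ℝ) * Real.pi ^ 2 + (-16 : ℝ) * Real.pi ^ 2 * (mFourier e2 x).im + (-16 : ℝ) * Real.pi ^ 2 * (mFourier e2 x).im ^ 2 + (-16 : ℝ) * Real.pi ^ 2 * (mFourier e2 x).re ^ 2) * hX + ((-24 : ℝ) * Real.pi ^ 2) * hY

set_option maxHeartbeats 3200000 in
/-- Coordinate `1` of `realTrigPoly S₂ c₂` is `σ`. [ours; elementary] -/
theorem aux₂_apply_one (x : UnitAddTorus (Fin 3)) :
    realTrigPoly S₂ c₂ x 1 = -(pX x * qX x * rX x) := by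
  have hX := normSq_mFourier e1 x
  have hY := normSq_mFourier e2 x
  rw [realTrigPoly_apply_coord, trigPoly_apply_coord, sum_S₂]
  simp only [c₂_apply_one, val_zero, val_m01, val_neg_m01, val_m02, val_neg_m02, val_m03, val_neg_m03, val_m04, val_neg_m04, val_m2n2, val_neg_m2n2, val_m2n1, val_neg_m2n1, val_m20, val_neg_m20, val_m21, val_neg_m21, val_m22, val_neg_m22, val_m23, val_neg_m23, val_m24, val_neg_m24, val_m40, val_neg_m40, val_m41, val_neg_m41, val_m42, val_neg_m42, val_m43, val_neg_m43, val_m44, val_neg_m44,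
    mFourier_neg, char_m01, char_m02, char_m03, char_m04, char_m2n2, char_m2n1, char_m20, char_m21, char_m22, char_m23, char_m24, char_m40, char_m41, char_m42, char_m43, char_m44, mFourier_zero, ContinuousMap.one_apply, pX, qX, rX]
  simp only [Complex.add_re, Complex.add_im, Complex.sub_re, Complex.sub_im, Complex.mul_re,
    Complex.mul_im, Complex.neg_re, Complex.neg_im, Complex.conj_re, Complex.conj_im, Complex.I_re,
    Complex.I_im, Complex.ofReal_re, Complex.ofReal_im, Complex.one_re, Complex.one_im, Complex.zero_re,
    Complex.zero_im, Complex.re_ofNat, Complex.im_ofNat, mul_zero, zero_mul, sub_zero, add_zero, mul_one,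
    one_mul, zero_add, zero_sub, neg_zero]
  linear_combination ((16 : ℝ) * Real.pi ^ 3 + (16 : ℝ) * Real.pi ^ 3 * (mFourier e2 x).im + (-48 : ℝ) * Real.pi ^ 3 * (mFourier e2 x).im ^ 2 + (-48 : ℝ) * Real.pi ^ 3 * (mFourier e2 x).im ^ 3 + (-16 : ℝ) * Real.pi ^ 3 * (mFourier e2 x).re ^ 2 + (-48 : ℝ) * Real.pi ^ 3 * (mFourier e2 x).re ^ 2 * (mFourier e2 x).im) * hX + ((-32 : ℝ) * Real.pi ^ 3 + (-48 : ℝ) * Real.pi ^ 3 * (mFourier e2 x).im + (32 : ℝ) * Real.pi ^ 3 * (mFourier e1 x).re * (mFourier e1 x).im * (mFourier e2 x).re + (32 : ℝ) * Real.pi ^ 3 * (mFourier e1 x).re ^ 2 + (32 : ℝ) * Real.pi ^ 3 * (mFourier e1 x).re ^ 2 * (mFourier e2 x).im) * hY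

set_option maxHeartbeats 6400000 in
/-- **Coordinate `2` of `realTrigPoly S₂ c₂` is `|ω|⁴`** (degree-8 identity). [ours; elementary] -/
theorem aux₂_apply_two (x : UnitAddTorus (Fin 3)) :
    realTrigPoly S₂ c₂ x 2 = (pX x ^ 2 + qX x ^ 2 + rX x ^ 2) ^ 2 := by
  have hX := normSq_mFourier e1 x
  have hY := normSq_mFourier e2 x
  rw [realTrigPoly_apply_coord, trigPoly_apply_coord, sum_S₂]
  simp only [c₂_apply_two, val_zero, val_m01, val_neg_m01, val_m02, val_neg_m02, val_m03, val_neg_m03, val_m04, val_neg_m04, val_m2n2, val_neg_m2n2, val_m2n1, val_neg_m2n1, val_m20, val_neg_m20, val_m21, val_neg_m21, val_m22, val_neg_m22, val_m23, val_neg_m23, val_m24, val_neg_m24, val_m40, val_neg_m40, val_m41, val_neg_m41, val_m42, val_neg_m42, val_m43, val_neg_m43, val_m44, val_neg_m44,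
    mFourier_neg, char_m01, char_m02, char_m03, char_m04, char_m2n2, char_m2n1, char_m20, char_m21, char_m22, char_m23, char_m24, char_m40, char_m41, char_m42, char_m43, char_m44, mFourier_zero, ContinuousMap.one_apply, pX, qX, rX]
  simp only [Complex.add_re, Complex.add_im, Complex.sub_re, Complex.sub_im, Complex.mul_re,
    Complex.mul_im, Complex.neg_re, Complex.neg_im, Complex.conj_re, Complex.conj_im, Complex.I_re,
    Complex.I_im, Complex.ofReal_re, Complex.ofReal_im, Complex.one_re, Complex.one_im, Complex.zero_re,
    Complex.zero_im, Complex.re_ofNat, Complex.im_ofNat, mul_zero, zero_mul, sub_zero, add_zero, mul_one,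
    one_mul, zero_add, zero_sub, neg_zero]
  linear_combination ((672 : ℝ) * Real.pi ^ 4 + (768 : ℝ) * Real.pi ^ 4 * (mFourier e2 x).im + (-896 : ℝ) * Real.pi ^ 4 * (mFourier e2 x).im ^ 2 + (-2432 : ℝ) * Real.pi ^ 4 * (mFourier e2 x).im ^ 3 + (-1792 : ℝ) * Real.pi ^ 4 * (mFourier e2 x).im ^ 4 + (-1664 : ℝ) * Real.pi ^ 4 * (mFourier e2 x).re ^ 2 + (-1920 : ℝ) * Real.pi ^ 4 * (mFourier e2 x).re ^ 2 * (mFourier e2 x).im + (-1536 : ℝ) * Real.pi ^ 4 * (mFourier e2 x).re ^ 2 * (mFourier e2 x).im ^ 2 + (256 : ℝ) * Real.pi ^ 4 * (mFourier e2 x).re ^ 4 + (-224 : ℝ) * Real.pi ^ 4 * (mFourier e1 x).im ^ 2 + (-896 : ℝ) * Real.pi ^ 4 * (mFourier e1 x).im ^ 2 * (mFourier e2 x).im + (-1792 : ℝ) * Real.pi ^ 4 * (mFourier e1 x).im ^ 2 * (mFourier e2 x).im ^ 2 + (-1792 : ℝ) * Real.pi ^ 4 * (mFourier e1 x).im ^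 2 * (mFourier e2 x).im ^ 3 + (-896 : ℝ) * Real.pi ^ 4 * (mFourier e1 x).im ^ 2 * (mFourier e2 x).im ^ 4 + (-256 : ℝ) * Real.pi ^ 4 * (mFourier e1 x).im ^ 2 * (mFourier e2 x).re ^ 2 + (-768 : ℝ) * Real.pi ^ 4 * (mFourier e1 x).im ^ 2 * (mFourier e2 x).re ^ 2 * (mFourier e2 x).im + (-768 : ℝ) * Real.pi ^ 4 * (mFourier e1 x).im ^ 2 * (mFourier e2 x).re ^ 2 * (mFourier e2 x).im ^ 2 + (128 : ℝ) * Real.pi ^ 4 * (mFourier e1 x).im ^ 2 * (mFourier e2 x).re ^ 4 + (512 : ℝ) * Real.pi ^ 4 * (mFourier e1 x).re * (mFourier e1 x).im * (mFourier e2 x).re + (2048 : ℝ) * Real.pi ^ 4 * (mFourier e1 x).re * (mFourier e1 x).im * (mFourier e2 x).re * (mFourier e2 x).im + (3072 : ℝ) * Real.pi ^ 4 * (mFourier e1 x).re * (mFourier e1 x).im * (mFourier e2 x).re * (mFourier e2 x).im ^ 2 + (2048 : ℝ) * Real.pi ^ 4 * (mFourier e1 x).re * (mFourier e1 x).im * (mFourier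 e2 x).re * (mFourier e2 x).im ^ 3 + (1024 : ℝ) * Real.pi ^ 4 * (mFourier e1 x).re * (mFourier e1 x).im * (mFourier e2 x).re ^ 3 + (2048 : ℝ) * Real.pi ^ 4 * (mFourier e1 x).re * (mFourier e1 x).im * (mFourier e2 x).re ^ 3 * (mFourier e2 x).im + (32 : ℝ) * Real.pi ^ 4 * (mFourier e1 x).re ^ 2 + (128 : ℝ) * Real.pi ^ 4 * (mFourier e1 x).re ^ 2 * (mFourier e2 x).im + (256 : ℝ) * Real.pi ^ 4 * (mFourier e1 x).re ^ 2 * (mFourier e2 x).im ^ 2 + (256 : ℝ) * Real.pi ^ 4 * (mFourier e1 x).re ^ 2 * (mFourier e2 x).im ^ 3 + (128 : ℝ) * Real.pi ^ 4 * (mFourier e1 x).re ^ 2 * (mFourier e2 x).im ^ 4 + (-256 : ℝ) * Real.pi ^ 4 * (mFourier e1 x).re ^ 2 * (mFourier e2 x).re ^ 2 + (-768 : ℝ) * Real.pi ^ 4 * (mFourier e1 x).re ^ 2 * (mFourier e2 x).re ^ 2 * (mFourier e2 x).im + (-768 : ℝ) * Real.pi ^ 4 * (mFourier e1 x).re ^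 2 * (mFourier e2 x).re ^ 2 * (mFourier e2 x).im ^ 2 + (-896 : ℝ) * Real.pi ^ 4 * (mFourier e1 x).re ^ 2 * (mFourier e2 x).re ^ 4) * hX + ((-2144 : ℝ) * Real.pi ^ 4 + (-2304 : ℝ) * Real.pi ^ 4 * (mFourier e2 x).im + (-2016 : ℝ) * Real.pi ^ 4 * (mFourier e2 x).im ^ 2 + (288 : ℝ) * Real.pi ^ 4 * (mFourier e2 x).re ^ 2 + (1792 : ℝ) * Real.pi ^ 4 * (mFourier e1 x).re * (mFourier e1 x).im * (mFourier e2 x).re + (3072 : ℝ) * Real.pi ^ 4 * (mFourier e1 x).re * (mFourier e1 x).im * (mFourier e2 x).re * (mFourier e2 x).im + (1536 : ℝ) * Real.pi ^ 4 * (mFourier e1 x).re ^ 2 + (2304 : ℝ) * Real.pi ^ 4 * (mFourier e1 x).re ^ 2 * (mFourier e2 x).im + (1792 : ℝ) * Real.pi ^ 4 * (mFourier e1 x).re ^ 2 * (mFourier e2 x).im ^ 2 + (-1280 : ℝ) * Real.pi ^ 4 * (mFourier e1 x).re ^ 2 * (mFourier e2 x).re ^ 2) * hY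

/-! ## 6. The exact integrals (Parseval) -/

set_option maxHeartbeats 1600000 in
/-- **`∫ |ω|⁴ = 92·(2π)⁴`** for the three-wave field (census-2 `Z₄ = 92`). [ours; elementary] -/
theorem integral_vorticitySq_sq_w : ∫ x, torusVorticitySqAt w x ^ 2 = 92 * (2 * Real.pi) ^ 4 := by
  have h := integral_mul_realTrigPoly neg_mem_S₁ isConjSymm_c₁ 0 0
  simp_rw [aux₁_apply_zero] at h
  simp_rw [torusVorticitySqAt_w, pow_two (pX _ ^ 2 + qX _ ^ 2 + rX _ ^ 2)]
  rw [h, sum_S₁]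
  simp only [c₁_apply_zero, val_zero, val_m01, val_neg_m01, val_m02, val_neg_m02, val_m20, val_neg_m20, val_m21, val_neg_m21, val_m22, val_neg_m22, val_m23, val_neg_m23]
  simp only [map_mul, Complex.conj_ofReal, map_ofNat, map_neg, Complex.conj_I, map_one, map_zero,
    Complex.add_re, Complex.add_im, Complex.sub_re, Complex.sub_im, Complex.mul_re,
    Complex.mul_im, Complex.neg_re, Complex.neg_im, Complex.conj_re, Complex.conj_im, Complex.I_re,
    Complex.I_im, Complex.ofReal_re, Complex.ofReal_im, Complex.one_re, Complex.one_im, Complex.zero_re,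
    Complex.zero_im, Complex.re_ofNat, Complex.im_ofNat, mul_zero, zero_mul, sub_zero, add_zero, mul_one,
    one_mul, zero_add, zero_sub, neg_zero]
  ring

set_option maxHeartbeats 1600000 in
/-- **`∫ |ω|² σ = 36·(2π)⁵`** for the three-wave field (census-2 `Q₂ = 36`). [ours; elementary] -/
theorem integral_vorticitySq_mul_stretching_w :
    ∫ x, torusVorticitySqAt w x * torusStretchingDensity w x = 36 * (2 * Real.pi) ^ 5 := by
  have h := integral_mul_realTrigPoly neg_mem_S₁ isConjSymm_c₁ 0 1
  simp_rw [aux₁_apply_zero, aux₁_apply_one] at h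
  simp_rw [torusVorticitySqAt_w, torusStretchingDensity_w]
  rw [h, sum_S₁]
  simp only [c₁_apply_zero, c₁_apply_one, val_zero, val_m01, val_neg_m01, val_m02, val_neg_m02, val_m20, val_neg_m20, val_m21, val_neg_m21, val_m22, val_neg_m22, val_m23, val_neg_m23]
  simp only [map_mul, Complex.conj_ofReal, map_ofNat, map_neg, Complex.conj_I, map_one, map_zero,
    Complex.add_re, Complex.add_im, Complex.sub_re, Complex.sub_im, Complex.mul_re,
    Complex.mul_im, Complex.neg_re, Complex.neg_im, Complex.conj_re, Complex.conj_im, Complex.I_re,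
    Complex.I_im, Complex.ofReal_re, Complex.ofReal_im, Complex.one_re, Complex.one_im, Complex.zero_re,
    Complex.zero_im, Complex.re_ofNat, Complex.im_ofNat, mul_zero, zero_mul, sub_zero, add_zero, mul_one,
    one_mul, zero_add, zero_sub, neg_zero]
  ring

set_option maxHeartbeats 3200000 in
/-- **`∫ |ω|⁶ = 1376·(2π)⁶`** for the three-wave field (census-2 `Z₆ = 1376`). [ours; elementary] -/
theorem integral_vorticitySq_cube_w : ∫ x, torusVorticitySqAt w x ^ 3 = 1376 * (2 * Real.pi) ^ 6 := by
  have h := integral_mul_realTrigPoly neg_mem_S₂ isConjSymm_c₂ 0 2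
  simp_rw [aux₂_apply_zero, aux₂_apply_two] at h
  have h3 : ∀ x, torusVorticitySqAt w x ^ 3 =
      (pX x ^ 2 + qX x ^ 2 + rX x ^ 2) * (pX x ^ 2 + qX x ^ 2 + rX x ^ 2) ^ 2 := by
    intro x; rw [torusVorticitySqAt_w]; ring
  simp_rw [h3]
  rw [h, sum_S₂]
  simp only [c₂_apply_zero, c₂_apply_two, val_zero, val_m01, val_neg_m01, val_m02, val_neg_m02, val_m03, val_neg_m03, val_m04, val_neg_m04, val_m2n2, val_neg_m2n2, val_m2n1, val_neg_m2n1, val_m20, val_neg_m20, val_m21, val_neg_m21, val_m22, val_neg_m22, val_m23, val_neg_m23, val_m24, val_neg_m24, val_m40, val_neg_m40, val_m41, val_neg_m41, val_m42, val_neg_m42, val_m43, val_neg_m43, val_m44, val_neg_m44]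
  simp only [map_mul, Complex.conj_ofReal, map_ofNat, map_neg, Complex.conj_I, map_one, map_zero,
    Complex.add_re, Complex.add_im, Complex.sub_re, Complex.sub_im, Complex.mul_re,
    Complex.mul_im, Complex.neg_re, Complex.neg_im, Complex.conj_re, Complex.conj_im, Complex.I_re,
    Complex.I_im, Complex.ofReal_re, Complex.ofReal_im, Complex.one_re, Complex.one_im, Complex.zero_re,
    Complex.zero_im, Complex.re_ofNat, Complex.im_ofNat, mul_zero, zero_mul, sub_zero, add_zero, mul_one,
    one_mul, zero_add, zero_sub, neg_zero]
  ring

set_option maxHeartbeats 3200000 in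
/-- **`∫ |ω|⁴ σ = 676·(2π)⁷`** for the three-wave field (census-2 `Q₃ = 676`). [ours; elementary] -/
theorem integral_vorticitySq_sq_mul_stretching_w :
    ∫ x, torusVorticitySqAt w x ^ 2 * torusStretchingDensity w x = 676 * (2 * Real.pi) ^ 7 := by
  have h := integral_mul_realTrigPoly neg_mem_S₂ isConjSymm_c₂ 2 1
  simp_rw [aux₂_apply_one, aux₂_apply_two] at h
  have h3 : ∀ x, torusVorticitySqAt w x ^ 2 * torusStretchingDensity w x =
      (pX x ^ 2 + qX x ^ 2 + rX x ^ 2) ^ 2 * (-(pX x * qX x * rX x)) := by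
    intro x; rw [torusVorticitySqAt_w, torusStretchingDensity_w]
  simp_rw [h3]
  rw [h, sum_S₂]
  simp only [c₂_apply_one, c₂_apply_two, val_zero, val_m01, val_neg_m01, val_m02, val_neg_m02, val_m03, val_neg_m03, val_m04, val_neg_m04, val_m2n2, val_neg_m2n2, val_m2n1, val_neg_m2n1, val_m20, val_neg_m20, val_m21, val_neg_m21, val_m22, val_neg_m22, val_m23, val_neg_m23, val_m24, val_neg_m24, val_m40, val_neg_m40, val_m41, val_neg_m41, val_m42, val_neg_m42, val_m43, val_neg_m43, val_m44, val_neg_m44]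
  simp only [map_mul, Complex.conj_ofReal, map_ofNat, map_neg, Complex.conj_I, map_one, map_zero,
    Complex.add_re, Complex.add_im, Complex.sub_re, Complex.sub_im, Complex.mul_re,
    Complex.mul_im, Complex.neg_re, Complex.neg_im, Complex.conj_re, Complex.conj_im, Complex.I_re,
    Complex.I_im, Complex.ofReal_re, Complex.ofReal_im, Complex.one_re, Complex.one_im, Complex.zero_re,
    Complex.zero_im, Complex.re_ofNat, Complex.im_ofNat, mul_zero, zero_mul, sub_zero, add_zero, mul_one,
    one_mul, zero_add, zero_sub, neg_zero]
  ring

/-! ## 7. The kills (door step = the tree lemma `MiddleEigenvalueMomentRateBound.static_evenMoment`) -/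

/-- **K1-Q2 finite-constant kills at `q = 4`: `¬ MiddleEigenvalueMomentRateBound 4 C` on `T³` for every
`C < 36/23 ≈ 1.565`.** The three-wave field: `Λ = 2π` admissible, `∫|ω|⁴ = 92(2π)⁴`, `∫|ω|²σ = 36(2π)⁵`,
and the static inequality `2·2·∫|ω|²σ ≤ C·Λ·∫|ω|⁴` reads `144 ≤ 92·C`. Finite-`C` kills of K0 rows
`E.q=4|T_C|C3b`, nothing more — search for candidate a priori estimates; no regularity claim. [ours] -/
theorem not_middleEigenvalueMomentRateBound_four {C : ℝ} (hC : C < 36 / 23) :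
    ¬ MiddleEigenvalueMomentRateBound (d := Fin 3) 4 C := by
  intro h
  have h' : MiddleEigenvalueMomentRateBound (d := Fin 3) (2 * (2 : ℕ)) C := by
    rw [show (2 : ℝ) * ((2 : ℕ) : ℝ) = 4 by norm_num]; exact h
  have hst := h'.static_evenMoment card_fin_three w isSmooth_w isDivFree_w Λ Λ_nonneg
    (middleEigenvalue_le_w card_fin_three)
  simp only [Nat.cast_ofNat, show (2 : ℕ) - 1 = 1 from rfl, pow_one] at hst
  rw [integral_vorticitySq_mul_stretching_w, integral_vorticitySq_sq_w] at hst
  -- `hst : 2 * 2 * (36 * (2π)^5) ≤ C * Λ * (92 * (2π)^4)`, false for `92 C < 144`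
  unfold Λ at hst
  have h5 : 0 < (2 * Real.pi) ^ 5 := by positivity
  nlinarith [mul_pos h5 (sub_pos.2 hC)]

/-- `¬ MiddleEigenvalueMomentRateBound 4 1` (the pre-registered kernel control `E.q=4|T_C|C3b`, `C = 1`).
Search for candidate a priori estimates; no regularity claim. [ours] -/
theorem not_middleEigenvalueMomentRateBound_four_one :
    ¬ MiddleEigenvalueMomentRateBound (d := Fin 3) 4 1 :=
  not_middleEigenvalueMomentRateBound_four (by norm_num)

/-- `¬ MiddleEigenvalueMomentRateBound 4 (3/2)`. Search for candidate a priori estimates; no regularity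
claim. [ours] -/
theorem not_middleEigenvalueMomentRateBound_four_three_halves :
    ¬ MiddleEigenvalueMomentRateBound (d := Fin 3) 4 (3 / 2) :=
  not_middleEigenvalueMomentRateBound_four (by norm_num)

/-- **K1-Q2 finite-constant kills at `q = 6`: `¬ MiddleEigenvalueMomentRateBound 6 C` on `T³` for every
`C < 507/172 ≈ 2.948`.** Same field and `Λ = 2π`: `∫|ω|⁶ = 1376(2π)⁶`, `∫|ω|⁴σ = 676(2π)⁷`, and
`2·3·∫|ω|⁴σ ≤ C·Λ·∫|ω|⁶` reads `4056 ≤ 1376·C`. In particular the Betchov–Miller calibration constant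
`C = 2` of `q = 2` FAILS at `q = 6`. Search for candidate a priori estimates; no regularity claim. [ours] -/
theorem not_middleEigenvalueMomentRateBound_six {C : ℝ} (hC : C < 507 / 172) :
    ¬ MiddleEigenvalueMomentRateBound (d := Fin 3) 6 C := by
  intro h
  have h' : MiddleEigenvalueMomentRateBound (d := Fin 3) (2 * (3 : ℕ)) C := by
    rw [show (2 : ℝ) * ((3 : ℕ) : ℝ) = 6 by norm_num]; exact h
  have hst := h'.static_evenMoment card_fin_three w isSmooth_w isDivFree_w Λ Λ_nonneg
    (middleEigenvalue_le_w card_fin_three)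
  simp only [Nat.cast_ofNat, show (3 : ℕ) - 1 = 2 from rfl] at hst
  rw [integral_vorticitySq_sq_mul_stretching_w, integral_vorticitySq_cube_w] at hst
  unfold Λ at hst
  have h7 : 0 < (2 * Real.pi) ^ 7 := by positivity
  nlinarith [mul_pos h7 (sub_pos.2 hC)]

/-- `¬ MiddleEigenvalueMomentRateBound 6 2` (the pre-registered kernel control `E.q=6|T_C|C3b`, `C = 2`).
Search for candidate a priori estimates; no regularity claim. [ours] -/
theorem not_middleEigenvalueMomentRateBound_six_two :
    ¬ MiddleEigenvalueMomentRateBound (d := Fin 3) 6 2 :=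
  not_middleEigenvalueMomentRateBound_six (by norm_num)

/-- `¬ MiddleEigenvalueMomentRateBound 6 (5/2)`. Search for candidate a priori estimates; no regularity
claim. [ours] -/
theorem not_middleEigenvalueMomentRateBound_six_five_halves :
    ¬ MiddleEigenvalueMomentRateBound (d := Fin 3) 6 (5 / 2) :=
  not_middleEigenvalueMomentRateBound_six (by norm_num)

end MiddleEigenKill

end Summit.NavierStokesRegularity.FunctionalMining

end
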